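import Literature.Analysis.FluidPDE.NormalisedPressureFarField
import HarnessLib

/-!
# The Hessian of the pressure of a compactly supported field far away: `|D²p| ≤ C|x|⁻⁵`

Analysis/FluidPDE support file (serves the formalisation of Scheffer's construction of singular
weak solutions of the Navier–Stokes inequality in the presentation of W. S. Ożański,
arXiv:1709.00602, §3.2, eq. (3.4), second half: for `u ∈ C_0^∞(ℝ³)` the pressure function
satisfies `|D²p(x)| ≤ C|x|⁻⁵`, the input of Lemma 7 (iii) `|∇F(x)| ≤ C|x|⁻⁵` for the pressure
interaction function; companion of `NormalisedPressureFarField`, which has the representation,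
`|p| ≲ |x|⁻³` and `|∇p| ≲ |x|⁻⁴`).

For the tree's normalised pressure `p̃[v] = normalisedPressure v` of `v ∈ C²(ℝ³; ℝ³)` supported in
`B̄(0, R)` and `|x| > R + 2` we prove

* `fderiv_fderiv_farPotential_apply_apply` — differentiating the far potential twice under the
  integral sign: `D²Q₂[v](x)(a,b) = ∫ D⁴Γ∞(x-y)(a, b, v y, v y) dy` (all `x`; `v` continuous
  with `|v|² ∈ L¹`);
* `fderiv_fderiv_normalisedPressure_apply_apply_of_lt_norm` —
  `D²p̃[v](x)(a,b) = -∫ D⁴Γ(x-y)(a, b, v y, v y) dy` for `|x| > R + 2`;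
* `exists_norm_fderiv4_newtonKernel_le` — `‖D⁴Γ(z)‖ ≤ M|z|⁻⁵`;
* `norm_fderiv_fderiv_normalisedPressure_le_of_lt_norm`,
  `exists_norm_fderiv_fderiv_normalisedPressure_le` —
  **`‖D²p̃[v](x)‖ ≤ C ‖v‖₂²/(|x|-R)⁵`** (Ożański 2017, (3.4)).

## Mathlib / tree search

Tree: `hasFDerivAt_integral_clm_apply_comp_sub`, `fderiv_integral_clm_apply_comp_sub_apply`,
`evalDiag`, `exists_bound_newtonFar_derivs`, `newtonFar_fderiv_iterates_eq`,
`fderiv4_newtonKernel_homogeneous`, `contDiffOn_fderiv4_newtonKernel` (`NewtonKernel`,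
`PressureRepresentation`); `nearPotential_eventuallyEq_zero_of_lt_norm`,
`fderiv_farPotential_apply` (`NormalisedPressureFarField`). Mathlib:
`ContinuousLinearMap.compL`, `ContinuousLinearMap.integral_apply`,
`ContinuousLinearMap.opNorm_le_bound₂`, `Filter.EventuallyEq.fderiv` (used).

## References

* W. S. Ożański, *On weak solutions to the Navier–Stokes inequality with internal
  singularities*, arXiv:1709.00602 (2017), §3.2 (3.4); Lemma 7 (iii). [`Ozanski2017NSISingular`]
-/

noncomputable section

open MeasureTheory Set Filter Metric Topology Function Real InnerProductSpace
open scoped RealInnerProductSpace ContDiff ENNReal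

namespace Literature.Analysis.FluidPDE

-- nested operator types `ℝ³ →L[ℝ] ℝ³ →L[ℝ] ℝ³ →L[ℝ] ℝ³ →L[ℝ] ℝ`
set_option maxSynthPendingDepth 4

variable {v : EuclideanSpace ℝ (Fin 3) → EuclideanSpace ℝ (Fin 3)} {R : ℝ}

/-! ### `‖D⁴Γ(z)‖ ≤ M/|z|⁵` -/

set_option maxHeartbeats 400000 in
/-- **`‖D⁴Γ(z)‖ ≤ M/|z|⁵`** with an absolute constant `M ≥ 0` (homogeneity of degree `-5` and
continuity on the unit sphere). [folklore] -/
theorem exists_norm_fderiv4_newtonKernel_le :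
    ∃ M : ℝ, 0 ≤ M ∧ ∀ z : EuclideanSpace ℝ (Fin 3), z ≠ 0 →
      ‖fderiv ℝ (fderiv ℝ (fderiv ℝ (fderiv ℝ newtonKernel))) z‖ ≤ M / ‖z‖ ^ 5 := by
  obtain ⟨M, hM⟩ := exists_bound_of_homogeneous _ (-5) (by norm_num)
    fderiv4_newtonKernel_homogeneous (contDiffOn_fderiv4_newtonKernel (n := 0)).continuousOn
    one_pos
  refine ⟨max M 0, le_max_right _ _, fun z hz => ?_⟩
  have hc : 0 < ‖z‖ := norm_pos_iff.2 hz
  set u : EuclideanSpace ℝ (Fin 3) := ‖z‖⁻¹ • z with hu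
  have hun : ‖u‖ = 1 := by
    rw [hu, norm_smul, norm_inv, norm_norm, inv_mul_cancel₀ hc.ne']
  have hzu : z = ‖z‖ • u := by rw [hu, smul_smul, mul_inv_cancel₀ hc.ne', one_smul]
  have hMu : ‖fderiv ℝ (fderiv ℝ (fderiv ℝ (fderiv ℝ newtonKernel))) u‖ ≤ max M 0 :=
    (hM u hun.ge).trans (le_max_left _ _)
  have key : fderiv ℝ (fderiv ℝ (fderiv ℝ (fderiv ℝ newtonKernel))) z =
      ‖z‖ ^ (-5 : ℤ) • fderiv ℝ (fderiv ℝ (fderiv ℝ (fderiv ℝ newtonKernel))) u := by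
    conv_lhs => rw [hzu]
    exact fderiv4_newtonKernel_homogeneous ‖z‖ hc u
  rw [key, norm_smul, norm_zpow, norm_norm, le_div_iff₀ (by positivity)]
  calc ‖z‖ ^ (-5 : ℤ) * ‖fderiv ℝ (fderiv ℝ (fderiv ℝ (fderiv ℝ newtonKernel))) u‖ * ‖z‖ ^ 5
      = ‖fderiv ℝ (fderiv ℝ (fderiv ℝ (fderiv ℝ newtonKernel))) u‖ := by
        rw [show ‖z‖ ^ (-5 : ℤ) = (‖z‖ ^ 5)⁻¹ by rw [zpow_neg]; norm_cast]
        field_simp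
    _ ≤ max M 0 := hMu

/-! ### Differentiating the far potential twice -/

/-- The gradient of the far potential as an operator-valued integral:
`DQ₂[v](x) = ∫ evalDiag(v y) ∘ D³Γ∞(x - y) dy` (`0 < r₀ < r₁`). [folklore] -/
theorem fderiv_farPotential_eq_integral {r₀ r₁ : ℝ} (h₀ : 0 < r₀) (h₁ : r₀ < r₁)
    (hv : Continuous v) (hL2 : Integrable fun y => ‖v y‖ ^ 2) :
    fderiv ℝ (farPotential r₀ r₁ v) = fun x =>
      ∫ y, (evalDiag (v y)).comp (fderiv ℝ (fderiv ℝ (fderiv ℝ (newtonFar r₀ r₁))) (x - y)) := by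
  obtain ⟨M₀, M₁, -, hM₀, hM₁, -⟩ := exists_bounds_fderiv2_newtonFar h₀ h₁
  have hΦ : ContDiff ℝ 1 (fderiv ℝ (fderiv ℝ (newtonFar r₀ r₁))) :=
    (contDiff_fderiv2_newtonFar h₀ h₁).of_le one_le_two
  funext x
  rw [farPotential_eq]
  exact (hasFDerivAt_integral_clm_apply_comp_sub (L := fun y => evalDiag (v y)) hΦ hM₀ hM₁
    (continuous_evalDiag.comp hv) (integrable_evalDiag_comp hv hL2) x).fderiv

/-- **Differentiating the far potential twice under the integral sign**:
`D²Q₂[v](x)(a, b) = ∫ D⁴Γ∞(x-y)(a, b, v y, v y) dy` for `v` continuous with `|v|² ∈ L¹`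
(`0 < r₀ < r₁`; bounded smooth kernel). [folklore] -/
theorem fderiv_fderiv_farPotential_apply_apply {r₀ r₁ : ℝ} (h₀ : 0 < r₀) (h₁ : r₀ < r₁)
    (hv : Continuous v) (hL2 : Integrable fun y => ‖v y‖ ^ 2) (x a b : EuclideanSpace ℝ (Fin 3)) :
    fderiv ℝ (fderiv ℝ (farPotential r₀ r₁ v)) x a b =
      ∫ y, fderiv ℝ (fderiv ℝ (fderiv ℝ (fderiv ℝ (newtonFar r₀ r₁)))) (x - y) a b (v y) (v y) := by
  obtain ⟨-, -, -, ⟨M₃, hM₃⟩, ⟨M₄, hM₄⟩⟩ := exists_bound_newtonFar_derivs h₀ h₁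
  -- regularity of the kernel `Φ' = D³Γ∞`
  have hΦ'1 : ContDiff ℝ 1 (fderiv ℝ (fderiv ℝ (fderiv ℝ (newtonFar r₀ r₁)))) :=
    (((contDiff_newtonFar h₀ h₁ (n := 4)).fderiv_right (m := 3) (by norm_num)).fderiv_right
      (m := 2) (by norm_num)).fderiv_right (m := 1) (by norm_num)
  -- the weights `L' y = (evalDiag (v y)) ∘ ·`
  have hL'c : Continuous fun y => (ContinuousLinearMap.compL ℝ (EuclideanSpace ℝ (Fin 3))
      ((EuclideanSpace ℝ (Fin 3)) →L[ℝ] (EuclideanSpace ℝ (Fin 3)) →L[ℝ] ℝ) ℝ) (evalDiag (v y)) :=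
    (ContinuousLinearMap.compL ℝ (EuclideanSpace ℝ (Fin 3)) ((EuclideanSpace ℝ (Fin 3)) →L[ℝ] (EuclideanSpace ℝ (Fin 3)) →L[ℝ] ℝ) ℝ).continuous.comp
      (continuous_evalDiag.comp hv)
  have hL'i : Integrable fun y => (ContinuousLinearMap.compL ℝ (EuclideanSpace ℝ (Fin 3))
      ((EuclideanSpace ℝ (Fin 3)) →L[ℝ] (EuclideanSpace ℝ (Fin 3)) →L[ℝ] ℝ) ℝ) (evalDiag (v y)) :=
    (ContinuousLinearMap.compL ℝ (EuclideanSpace ℝ (Fin 3)) ((EuclideanSpace ℝ (Fin 3)) →L[ℝ] (EuclideanSpace ℝ (Fin 3)) →L[ℝ] ℝ) ℝ).integrable_comp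
      (integrable_evalDiag_comp hv hL2)
  -- the gradient as a parametric integral of the right shape
  have hgrad : fderiv ℝ (farPotential r₀ r₁ v) = fun x => ∫ y,
      (ContinuousLinearMap.compL ℝ (EuclideanSpace ℝ (Fin 3)) ((EuclideanSpace ℝ (Fin 3)) →L[ℝ] (EuclideanSpace ℝ (Fin 3)) →L[ℝ] ℝ) ℝ) (evalDiag (v y))
        (fderiv ℝ (fderiv ℝ (fderiv ℝ (newtonFar r₀ r₁))) (x - y)) := by
    rw [fderiv_farPotential_eq_integral h₀ h₁ hv hL2]
    funext x
    refine integral_congr_ae (Eventually.of_forall fun y => ?_)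
    simp only [ContinuousLinearMap.compL_apply]
  rw [hgrad, fderiv_integral_clm_apply_comp_sub_apply
    (Φ := fderiv ℝ (fderiv ℝ (fderiv ℝ (newtonFar r₀ r₁))))
    (L := fun y => (ContinuousLinearMap.compL ℝ (EuclideanSpace ℝ (Fin 3)) ((EuclideanSpace ℝ (Fin 3)) →L[ℝ] (EuclideanSpace ℝ (Fin 3)) →L[ℝ] ℝ) ℝ) (evalDiag (v y)))
    hΦ'1 hM₃ hM₄ hL'c hL'i x a]
  -- move the evaluation at `b` inside the integral
  have hM₄0 : 0 ≤ M₄ := (norm_nonneg _).trans (hM₄ 0)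
  have hint : Integrable fun y =>
      (ContinuousLinearMap.compL ℝ (EuclideanSpace ℝ (Fin 3)) ((EuclideanSpace ℝ (Fin 3)) →L[ℝ] (EuclideanSpace ℝ (Fin 3)) →L[ℝ] ℝ) ℝ) (evalDiag (v y))
        (fderiv ℝ (fderiv ℝ (fderiv ℝ (fderiv ℝ (newtonFar r₀ r₁)))) (x - y) a) := by
    refine Integrable.mono' (hL2.mul_const (M₄ * ‖a‖))
      ((hL'c.clm_apply (((hΦ'1.continuous_fderiv one_ne_zero).comp
        (continuous_const.sub continuous_id)).clm_apply continuous_const))).aestronglyMeasurable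
      (Eventually.of_forall fun y => ?_)
    rw [ContinuousLinearMap.compL_apply]
    calc ‖(evalDiag (v y)).comp (fderiv ℝ (fderiv ℝ (fderiv ℝ (fderiv ℝ (newtonFar r₀ r₁)))) (x - y) a)‖
        ≤ ‖evalDiag (v y)‖ * ‖fderiv ℝ (fderiv ℝ (fderiv ℝ (fderiv ℝ (newtonFar r₀ r₁)))) (x - y) a‖ :=
          ContinuousLinearMap.opNorm_comp_le _ _
      _ ≤ ‖v y‖ ^ 2 * (‖fderiv ℝ (fderiv ℝ (fderiv ℝ (fderiv ℝ (newtonFar r₀ r₁)))) (x - y)‖ * ‖a‖) :=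
          mul_le_mul (norm_evalDiag_le _) (ContinuousLinearMap.le_opNorm _ _) (norm_nonneg _)
            (sq_nonneg _)
      _ ≤ ‖v y‖ ^ 2 * (M₄ * ‖a‖) :=
          mul_le_mul_of_nonneg_left (mul_le_mul_of_nonneg_right (hM₄ _) (norm_nonneg _))
            (sq_nonneg _)
  rw [ContinuousLinearMap.integral_apply hint b]
  refine integral_congr_ae (Eventually.of_forall fun y => ?_)
  simp only [ContinuousLinearMap.compL_apply, ContinuousLinearMap.comp_apply, evalDiag_apply]

/-! ### The Hessian of the pressure far from the support -/

/-- **The Hessian of the normalised pressure far from the support**: for `v ∈ C²` supported in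
`B̄(0,R)` and `|x| > R + 2`, `D²p̃[v](x)(a,b) = -∫ D⁴Γ(x-y)(a, b, v y, v y) dy`.
[cite: Ozanski2017NSISingular, §3.2 (3.4)] -/
theorem fderiv_fderiv_normalisedPressure_apply_apply_of_lt_norm (hv : ContDiff ℝ 2 v)
    (hsupp : tsupport v ⊆ closedBall (0 : EuclideanSpace ℝ (Fin 3)) R)
    {x : EuclideanSpace ℝ (Fin 3)} (hx : R + 2 < ‖x‖) (a b : EuclideanSpace ℝ (Fin 3)) :
    fderiv ℝ (fderiv ℝ (normalisedPressure v)) x a b =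
      -∫ y, fderiv ℝ (fderiv ℝ (fderiv ℝ (fderiv ℝ newtonKernel))) (x - y) a b (v y) (v y) := by
  have hvc := hv.continuous
  have hL2 := integrable_norm_sq_of_tsupport_subset hvc hsupp
  rw [normalisedPressure_eq_pressurePotential' hv hL2]
  -- `Q[v] = -Q₂[v]` near `x`, hence the same for the gradients near `x`
  have hP : pressurePotential v =ᶠ[𝓝 x] fun w => -farPotential 1 2 v w := by
    filter_upwards [nearPotential_eventuallyEq_zero_of_lt_norm hsupp hx] with w hw
    rw [pressurePotential, hw]
    ring
  have hD : fderiv ℝ (pressurePotential v) =ᶠ[𝓝 x] fderiv ℝ (fun w => -farPotential 1 2 v w) :=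
    hP.fderiv
  have hneg : fderiv ℝ (fun w => -farPotential 1 2 v w) = -fderiv ℝ (farPotential 1 2 v) := by
    funext w
    exact fderiv_neg
  rw [hD.fderiv_eq, hneg, fderiv_neg, _root_.FunLike.coe_neg, Pi.neg_apply,
    _root_.FunLike.coe_neg, Pi.neg_apply,
    fderiv_fderiv_farPotential_apply_apply one_pos one_lt_two hvc hL2 x a b, ← integral_neg,
    ← integral_neg]
  refine integral_congr_ae (Eventually.of_forall fun y => ?_)
  simp only
  by_cases hy : y ∈ tsupport v
  · rw [(newtonFar_fderiv_iterates_eq zero_le_one one_lt_two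
      (two_lt_norm_sub_of_mem_tsupport hsupp hx hy)).2.2.2.2]
  · simp [image_eq_zero_of_notMem_tsupport hy]

/-- **Decay of the pressure Hessian** (Ożański 2017, (3.4), second half: `|D²p| ≤ C|x|⁻⁵`):
for `v ∈ C²` supported in `B̄(0,R)`, `|x| > R + 2`, and any `M ≥ 0` with `‖D⁴Γ(z)‖ ≤ M/|z|⁵`,
`‖D²p̃[v](x)‖ ≤ M ‖v‖₂²/(|x|-R)⁵`. [cite: Ozanski2017NSISingular, §3.2 (3.4)] -/
theorem norm_fderiv_fderiv_normalisedPressure_le_of_lt_norm (hv : ContDiff ℝ 2 v)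
    (hsupp : tsupport v ⊆ closedBall (0 : EuclideanSpace ℝ (Fin 3)) R)
    {x : EuclideanSpace ℝ (Fin 3)} (hx : R + 2 < ‖x‖) {M : ℝ} (hM0 : 0 ≤ M)
    (hM : ∀ z : EuclideanSpace ℝ (Fin 3), z ≠ 0 →
      ‖fderiv ℝ (fderiv ℝ (fderiv ℝ (fderiv ℝ newtonKernel))) z‖ ≤ M / ‖z‖ ^ 5) :
    ‖fderiv ℝ (fderiv ℝ (normalisedPressure v)) x‖ ≤ M * (∫ y, ‖v y‖ ^ 2) / (‖x‖ - R) ^ 5 := by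
  have hd : 0 < ‖x‖ - R := by linarith
  have hL2 := integrable_norm_sq_of_tsupport_subset hv.continuous hsupp
  have hE0 : 0 ≤ ∫ y, ‖v y‖ ^ 2 := integral_nonneg fun y => sq_nonneg _
  have hd5 : 0 < (‖x‖ - R) ^ 5 := pow_pos hd 5
  refine ContinuousLinearMap.opNorm_le_bound₂ _ (div_nonneg (mul_nonneg hM0 hE0) hd5.le)
    fun a b => ?_
  have hconst : M * (∫ y, ‖v y‖ ^ 2) / (‖x‖ - R) ^ 5 * ‖a‖ * ‖b‖ =
      ∫ y, M / (‖x‖ - R) ^ 5 * ‖a‖ * ‖b‖ * ‖v y‖ ^ 2 := by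
    rw [integral_const_mul]
    ring
  rw [fderiv_fderiv_normalisedPressure_apply_apply_of_lt_norm hv hsupp hx a b, norm_neg, hconst]
  refine norm_integral_le_of_norm_le ((hL2.const_mul _)) (Eventually.of_forall fun y => ?_)
  by_cases hy : y ∈ tsupport v
  · have hxy : ‖x‖ - R ≤ ‖x - y‖ := norm_sub_le_norm_sub_of_mem_tsupport hsupp hy
    have hxy0 : x - y ≠ 0 := by
      intro h; rw [h, norm_zero] at hxy; linarith
    have hK : ‖fderiv ℝ (fderiv ℝ (fderiv ℝ (fderiv ℝ newtonKernel))) (x - y)‖ ≤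
        M / (‖x‖ - R) ^ 5 :=
      (hM _ hxy0).trans (div_le_div_of_nonneg_left hM0 hd5 (pow_le_pow_left₀ hd.le hxy 5))
    calc ‖fderiv ℝ (fderiv ℝ (fderiv ℝ (fderiv ℝ newtonKernel))) (x - y) a b (v y) (v y)‖
        ≤ ‖fderiv ℝ (fderiv ℝ (fderiv ℝ (fderiv ℝ newtonKernel))) (x - y) a b (v y)‖ * ‖v y‖ :=
          ContinuousLinearMap.le_opNorm _ _
      _ ≤ ‖fderiv ℝ (fderiv ℝ (fderiv ℝ (fderiv ℝ newtonKernel))) (x - y) a b‖ * ‖v y‖ * ‖v y‖ :=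
          mul_le_mul_of_nonneg_right (ContinuousLinearMap.le_opNorm _ _) (norm_nonneg _)
      _ ≤ ‖fderiv ℝ (fderiv ℝ (fderiv ℝ (fderiv ℝ newtonKernel))) (x - y) a‖ * ‖b‖ * ‖v y‖ * ‖v y‖ :=
          mul_le_mul_of_nonneg_right (mul_le_mul_of_nonneg_right
            (ContinuousLinearMap.le_opNorm _ _) (norm_nonneg _)) (norm_nonneg _)
      _ ≤ ‖fderiv ℝ (fderiv ℝ (fderiv ℝ (fderiv ℝ newtonKernel))) (x - y)‖ * ‖a‖ * ‖b‖ * ‖v y‖ *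
            ‖v y‖ :=
          mul_le_mul_of_nonneg_right (mul_le_mul_of_nonneg_right (mul_le_mul_of_nonneg_right
            (ContinuousLinearMap.le_opNorm _ _) (norm_nonneg _)) (norm_nonneg _)) (norm_nonneg _)
      _ ≤ M / (‖x‖ - R) ^ 5 * ‖a‖ * ‖b‖ * ‖v y‖ * ‖v y‖ :=
          mul_le_mul_of_nonneg_right (mul_le_mul_of_nonneg_right (mul_le_mul_of_nonneg_right
            (mul_le_mul_of_nonneg_right hK (norm_nonneg _)) (norm_nonneg _)) (norm_nonneg _))
            (norm_nonneg _)
      _ = M / (‖x‖ - R) ^ 5 * ‖a‖ * ‖b‖ * ‖v y‖ ^ 2 := by ring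
  · rw [image_eq_zero_of_notMem_tsupport hy]
    simp only [map_zero, norm_zero]
    positivity

/-- **Decay of the pressure Hessian, packaged** (Ożański 2017, (3.4)): there is an absolute
constant `C ≥ 0` such that for every `v ∈ C²(ℝ³; ℝ³)` supported in `B̄(0,R)` and every
`|x| > R + 2`, `‖D²p̃[v](x)‖ ≤ C ‖v‖₂²/(|x|-R)⁵`. [cite: Ozanski2017NSISingular, §3.2 (3.4)] -/
theorem exists_norm_fderiv_fderiv_normalisedPressure_le :
    ∃ C : ℝ, 0 ≤ C ∧ ∀ (v : EuclideanSpace ℝ (Fin 3) → EuclideanSpace ℝ (Fin 3)) (R : ℝ)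
      (x : EuclideanSpace ℝ (Fin 3)), ContDiff ℝ 2 v →
      tsupport v ⊆ closedBall (0 : EuclideanSpace ℝ (Fin 3)) R → R + 2 < ‖x‖ →
        ‖fderiv ℝ (fderiv ℝ (normalisedPressure v)) x‖ ≤ C * (∫ y, ‖v y‖ ^ 2) / (‖x‖ - R) ^ 5 := by
  obtain ⟨M, hM0, hM⟩ := exists_norm_fderiv4_newtonKernel_le
  exact ⟨M, hM0, fun v R x hv hsupp hx =>
    norm_fderiv_fderiv_normalisedPressure_le_of_lt_norm hv hsupp hx hM0 hM⟩

end Literature.Analysis.FluidPDE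

end
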